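import Summits.MatrixMultiplication.MatrixMultiplication.Theses.SnSubsetDichotomy

/-!
# Sketch — crux-ideate stmt-MatrixMultiplication-10882 (ThresholdSubsetTriples), ideator 1, round 1

First lemmas of the two idea cards (statements must elaborate; proofs are not required at this stage):

* Card `interleaved-subsignature-ascent`: star-transposition sub-signature classes `subsig D` of a
  direction system (exact product cardinality `SubsigCard`), the level-TPP lemma for pairwise disjoint
  direction sets `levelTPP_of_disjoint`, the transfer `SubsignatureThreshold → ThresholdSubsetTriples`.
* Card `triality-uniquely-cubing-translate`: TPP for `(S, gS, g²S)` with `g³ = 1` is the statement that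
  `W = Q(S)·g` cubes to `1` only as `g·g·g` (`tpp_leftTranslates_iff`, `tpp_iff_uniquelyCubing`), and the
  pigeonhole collapse of single-point itinerary certificates `quotient_meets_stabilizer`.
-/

namespace Summit.MatrixMultiplication.MatrixMultiplication.Cruxes.ThresholdSubsetTriples.Ideator1

open Literature.Combinatorics.Additive

section Subsignature

variable {n : ℕ}

/-- A direction system: level `k` may use directions `d ≤ k` (the direction `d = k` encodes the
identity letter `swap k k = 1`). -/
def IsDirectionSystem (D : Fin n → Finset (Fin n)) : Prop :=
  ∀ k, ∀ d ∈ D k, d ≤ k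

/-- The word of a choice of directions: `swap (d (n-1)) (n-1) * ⋯ * swap (d 1) 1 * swap (d 0) 0`
(Fisher–Yates / Sims factorisation along the point-stabiliser chain, star transpositions as coset
representatives). -/
def sigWord (d : Fin n → Fin n) : Equiv.Perm (Fin n) :=
  (((List.finRange n).reverse).map fun k => Equiv.swap (d k) k).prod

/-- The sub-signature class of a direction system: all words with `d k ∈ D k` for every level `k`.
Young subgroups (for a block-compatible labelling) are the case `D k = {j ≤ k : j ∼ k}`. -/
def subsig (D : Fin n → Finset (Fin n)) : Finset (Equiv.Perm (Fin n)) :=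
  (Fintype.piFinset D).image sigWord

/-- Exact (entropy-exact, Stirling-free) cardinality of sub-signature classes: unique factorisation
along the stabiliser chain. [provable now] -/
def SubsigCard : Prop :=
  ∀ (n : ℕ) (D : Fin n → Finset (Fin n)), IsDirectionSystem D → (subsig D).card = ∏ k, (D k).card

/-- C⁺ of the card: POLYNOMIAL-slack TPP triples of three sub-signature classes of one common chain. -/
def SubsignatureThreshold : Prop :=
  ∃ C : ℝ, ∀ n₀ : ℕ, ∃ n ≥ n₀, ∃ DA DB DC : Fin n → Finset (Fin n),
    IsDirectionSystem DA ∧ IsDirectionSystem DB ∧ IsDirectionSystem DC ∧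
    TripleProductProperty (subsig DA) (subsig DB) (subsig DC) ∧
    (n.factorial : ℝ) ^ ((3 : ℝ) / 2) ≤
      (n : ℝ) ^ C * (((subsig DA).card * (subsig DB).card * (subsig DC).card : ℕ) : ℝ)

/-- Transfer: polynomial slack beats `e^{-c√n}` eventually, and the structure is forgotten.
[provable now: for `n` large, `n^{-C} > e^{-c√n}`] -/
theorem threshold_of_subsignature :
    SubsignatureThreshold → Theses.SnSubsetDichotomy.ThresholdSubsetTriples := by
  rintro ⟨C, hC⟩ c hc n₀
  set C' : ℝ := max C 1 with hC'
  have hC'1 : 1 ≤ C' := le_max_right _ _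
  have hC'0 : 0 < C' := by linarith
  obtain ⟨M, hM⟩ := exists_nat_ge ((4 * C' / c) ^ 4)
  obtain ⟨n, hn, DA, DB, DC, -, -, -, hTPP, hle⟩ := hC (max n₀ (max 1 M))
  have hn₀ : n₀ ≤ n := le_trans (le_max_left _ _) hn
  have hn1 : 1 ≤ n := le_trans (le_trans (le_max_left _ _) (le_max_right _ _)) hn
  have hnM : M ≤ n := le_trans (le_trans (le_max_right _ _) (le_max_right _ _)) hn
  refine ⟨n, hn₀, subsig DA, subsig DB, subsig DC, hTPP, ?_⟩
  set V : ℝ := (((subsig DA).card * (subsig DB).card * (subsig DC).card : ℕ) : ℝ) with hV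
  set F : ℝ := (n.factorial : ℝ) ^ ((3 : ℝ) / 2) with hF
  have hF0 : 0 < F := Real.rpow_pos_of_pos (by exact_mod_cast n.factorial_pos) _
  have hnR : (1 : ℝ) ≤ n := by exact_mod_cast hn1
  have hnpos : (0 : ℝ) < n := by linarith
  have hpow : (n : ℝ) ^ C ≤ (n : ℝ) ^ C' := Real.rpow_le_rpow_of_exponent_le hnR (le_max_left _ _)
  have hV0 : 0 ≤ V := by positivity
  have hle' : F ≤ (n : ℝ) ^ C' * V := hle.trans (mul_le_mul_of_nonneg_right hpow hV0)
  have hVpos : 0 < V := by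
    by_contra hV'
    push_neg at hV'
    have h0 : V = 0 := le_antisymm hV' hV0
    rw [h0, mul_zero] at hle'
    linarith
  -- key estimate: n^C' < exp (c √n), via log n = 4 log (n^{1/4}) < 4 n^{1/4} and 4 C' ≤ c n^{1/4}
  set r : ℝ := (n : ℝ) ^ ((1 : ℝ) / 4) with hr
  have hr0 : 0 < r := Real.rpow_pos_of_pos hnpos _
  have hr4 : r ^ 4 = n := by
    rw [hr, ← Real.rpow_natCast, ← Real.rpow_mul hnpos.le]; norm_num
  have hr2 : r * r = Real.sqrt n := by
    rw [Real.sqrt_eq_rpow, hr, ← Real.rpow_add hnpos]; norm_num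
  have hlogn : Real.log n = 4 * Real.log r := by
    rw [hr, Real.log_rpow hnpos]; ring
  have hlogr : Real.log r < r := by
    have := Real.log_le_sub_one_of_pos hr0; linarith
  have hMn : (4 * C' / c) ^ 4 ≤ (n : ℝ) := hM.trans (by exact_mod_cast hnM)
  have hrge : 4 * C' / c ≤ r := by
    by_contra hlt
    push_neg at hlt
    have h4 : r ^ 4 < (4 * C' / c) ^ 4 := pow_lt_pow_left₀ hlt hr0.le (by norm_num)
    rw [hr4] at h4
    linarith
  have hkey : (n : ℝ) ^ C' < Real.exp (c * Real.sqrt n) := by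
    rw [Real.rpow_def_of_pos hnpos]
    apply Real.exp_lt_exp.2
    have h1 : Real.log n * C' < 4 * r * C' := by
      rw [hlogn]; nlinarith
    have h2 : 4 * C' ≤ c * r := by
      have := (div_le_iff₀ hc).1 hrge; linarith
    calc Real.log n * C' < 4 * r * C' := h1
      _ = (4 * C') * r := by ring
      _ ≤ (c * r) * r := mul_le_mul_of_nonneg_right h2 hr0.le
      _ = c * Real.sqrt n := by rw [mul_assoc, hr2]
  calc F * Real.exp (-(c * Real.sqrt n))
      ≤ (n : ℝ) ^ C' * V * Real.exp (-(c * Real.sqrt n)) :=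
        mul_le_mul_of_nonneg_right hle' (Real.exp_pos _).le
    _ = V * ((n : ℝ) ^ C' * Real.exp (-(c * Real.sqrt n))) := by ring
    _ < V * 1 := by
        apply mul_lt_mul_of_pos_left _ hVpos
        rw [Real.exp_neg, mul_inv_lt_iff₀ (Real.exp_pos _), one_mul]
        exact hkey
    _ = V := mul_one _

/-- LEVEL LEMMA (top level, trivial lower triple): three pairwise disjoint direction sets at a common
token point `t` give a TPP triple of star transpositions — the single-level case of the token
(itinerary) calculus; no condition `d ≤ t` is needed. [provable now: track the token `t`] -/
/- token calculus, one level: a pair-quotient of star transpositions is trivial or parks the token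
inside its own direction set, and fixes every point outside its direction set and `t`. -/
private theorem pair_fixes (D : Finset (Fin n)) {x x' : Fin n} (t z : Fin n) (hx : x ∈ D) (hx' : x' ∈ D)
    (hz : z ∉ D) (hzt : z ≠ t) : (Equiv.swap x t * Equiv.swap x' t) z = z := by
  have hzx : z ≠ x := fun h => hz (h ▸ hx)
  have hzx' : z ≠ x' := fun h => hz (h ▸ hx')
  simp [Equiv.Perm.mul_apply, Equiv.swap_apply_of_ne_of_ne hzx' hzt, Equiv.swap_apply_of_ne_of_ne hzx hzt]

private theorem pair_dichotomy (D : Finset (Fin n)) {x x' : Fin n} (t : Fin n) (hx : x ∈ D) (hx' : x' ∈ D) :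
    Equiv.swap x t * Equiv.swap x' t = 1 ∨
      ((Equiv.swap x t * Equiv.swap x' t) t ∈ D ∧ (Equiv.swap x t * Equiv.swap x' t) t ≠ t) := by
  by_cases hxx : x' = x
  · left; subst hxx; ext y; simp [Equiv.Perm.mul_apply]
  by_cases hx't : x' = t
  · right
    rw [hx't, Equiv.swap_self]
    simp only [Equiv.Perm.mul_apply, Equiv.refl_apply, Equiv.swap_apply_right]
    exact ⟨hx, fun h => hxx (hx't.trans h.symm)⟩
  · right
    have h1 : (Equiv.swap x t * Equiv.swap x' t) t = x' := by
      rw [Equiv.Perm.mul_apply, Equiv.swap_apply_right, Equiv.swap_apply_of_ne_of_ne hxx hx't]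
    rw [h1]; exact ⟨hx', hx't⟩

theorem levelTPP_of_disjoint (t : Fin n) (DA DB DC : Finset (Fin n))
    (hAB : Disjoint DA DB) (hBC : Disjoint DB DC) (hAC : Disjoint DA DC) :
    TripleProductProperty (DA.image fun d => Equiv.swap d t) (DB.image fun d => Equiv.swap d t)
      (DC.image fun d => Equiv.swap d t) := by
  intro s hs s' hs' u hu u' hu' v hv v' hv' E
  obtain ⟨a, ha, rfl⟩ := Finset.mem_image.1 hs
  obtain ⟨a', ha', rfl⟩ := Finset.mem_image.1 hs'
  obtain ⟨b, hb, rfl⟩ := Finset.mem_image.1 hu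
  obtain ⟨b', hb', rfl⟩ := Finset.mem_image.1 hu'
  obtain ⟨c, hc, rfl⟩ := Finset.mem_image.1 hv
  obtain ⟨c', hc', rfl⟩ := Finset.mem_image.1 hv'
  simp only [Equiv.swap_inv] at E
  -- disjointness as pointwise facts
  have dAB : ∀ z, z ∈ DB → z ∉ DA := fun z hzB hzA => Finset.disjoint_left.1 hAB hzA hzB
  have dAC : ∀ z, z ∈ DC → z ∉ DA := fun z hzC hzA => Finset.disjoint_left.1 hAC hzA hzC
  have dBC : ∀ z, z ∈ DC → z ∉ DB := fun z hzC hzB => Finset.disjoint_left.1 hBC hzB hzC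
  set PA := Equiv.swap a t * Equiv.swap a' t with hPA
  set PB := Equiv.swap b t * Equiv.swap b' t with hPB
  set PC := Equiv.swap c t * Equiv.swap c' t with hPC
  have E' : PA * PB * PC = 1 := by simpa [hPA, hPB, hPC, mul_assoc] using E
  -- step C
  have hC1 : PC = 1 := by
    rcases pair_dichotomy DC t hc hc' with h | ⟨hmem, hne⟩
    · exact h
    · exfalso
      have hz := congrArg (fun p : Equiv.Perm (Fin n) => p t) E'
      simp only [Equiv.Perm.mul_apply, Equiv.Perm.one_apply] at hz
      rw [pair_fixes DB t _ hb hb' (dBC _ hmem) hne, pair_fixes DA t _ ha ha' (dAC _ hmem) hne] at hz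
      exact hne hz
  rw [hC1, mul_one] at E'
  have hB1 : PB = 1 := by
    rcases pair_dichotomy DB t hb hb' with h | ⟨hmem, hne⟩
    · exact h
    · exfalso
      have hz := congrArg (fun p : Equiv.Perm (Fin n) => p t) E'
      simp only [Equiv.Perm.mul_apply, Equiv.Perm.one_apply] at hz
      rw [pair_fixes DA t _ ha ha' (dAB _ hmem) hne] at hz
      exact hne hz
  rw [hB1, mul_one] at E'
  have key : ∀ x x' : Fin n, Equiv.swap x t * Equiv.swap x' t = 1 → Equiv.swap x t = Equiv.swap x' t :=
    fun x x' h => by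
      have := congrArg (· * Equiv.swap x' t) h
      simpa [mul_assoc] using this
  exact ⟨key _ _ E', key _ _ hB1, key _ _ hC1⟩

/-- Recursive structure used by the ascent: the class of an `(n+1)`-point system is the top level
piece times the class of the restricted system (stated as a Prop; the restriction lives on
`Fin n ↪ Fin (n+1)` via `Fin.castSucc`). [provable now] -/
def SubsigSucc : Prop :=
  ∀ (n : ℕ) (D : Fin (n + 1) → Finset (Fin (n + 1))), IsDirectionSystem D →
    ∀ σ : Equiv.Perm (Fin (n + 1)), σ ∈ subsig D ↔
      ∃ d ∈ D (Fin.last n), ∃ τ ∈ subsig D, τ (Fin.last n) = Fin.last n ∧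
        σ = Equiv.swap d (Fin.last n) * τ

end Subsignature

section Triality

variable {G : Type*} [Group G] [DecidableEq G]

/-- `W` cubes to `1` only as `g · g · g`. -/
def UniquelyCubing (W : Finset G) (g : G) : Prop :=
  ∀ w₁ ∈ W, ∀ w₂ ∈ W, ∀ w₃ ∈ W, w₁ * w₂ * w₃ = 1 → w₁ = g ∧ w₂ = g ∧ w₃ = g

/-- TRIALITY REDUCTION: for `g³ = 1`, the triple `(S, gS, g²S)` of left translates has the TPP iff
`q₁ g q₂ g q₃ g = 1` with `qᵢ ∈ Q(S)` forces `qᵢ = 1` (Neumann 2011 Obs. 2.1: left translation by a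
common element and independent right translations preserve the TPP, so this is the general
`ℤ/3`-equivariant ansatz up to equivalence). [provable now: `t t'⁻¹ = g q₂ g⁻¹`, `u u'⁻¹ = g² q₃ g⁻²`] -/
theorem tpp_leftTranslates_iff (S : Finset G) (g : G) (hg : g ^ 3 = 1) :
    TripleProductProperty S (S.image (g * ·)) (S.image (g * g * ·)) ↔
      ∀ s₁ ∈ S, ∀ s₁' ∈ S, ∀ s₂ ∈ S, ∀ s₂' ∈ S, ∀ s₃ ∈ S, ∀ s₃' ∈ S,
        s₁ * s₁'⁻¹ * g * (s₂ * s₂'⁻¹) * g * (s₃ * s₃'⁻¹) * g = 1 →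
          s₁ = s₁' ∧ s₂ = s₂' ∧ s₃ = s₃' := by
  have hg3 : g * g * g = 1 := by simpa [pow_succ, mul_assoc] using hg
  constructor
  · intro h s₁ hs₁ s₁' hs₁' s₂ hs₂ s₂' hs₂' s₃ hs₃ s₃' hs₃' heq
    have key := h s₁ hs₁ s₁' hs₁' (g * s₂) (Finset.mem_image_of_mem _ hs₂) (g * s₂')
      (Finset.mem_image_of_mem _ hs₂') (g * g * s₃) (Finset.mem_image_of_mem _ hs₃) (g * g * s₃')
      (Finset.mem_image_of_mem _ hs₃') (by
        calc s₁ * s₁'⁻¹ * (g * s₂ * (g * s₂')⁻¹) * (g * g * s₃ * (g * g * s₃')⁻¹)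
            = (s₁ * s₁'⁻¹ * g * (s₂ * s₂'⁻¹) * g * (s₃ * s₃'⁻¹) * g) * (g * g * g)⁻¹ := by group
          _ = 1 := by rw [heq, hg3]; group)
    exact ⟨key.1, mul_left_cancel key.2.1, mul_left_cancel key.2.2⟩
  · intro h s hs s' hs' t ht t' ht' u hu u' hu' heq
    obtain ⟨s₂, hs₂, rfl⟩ := Finset.mem_image.1 ht
    obtain ⟨s₂', hs₂', rfl⟩ := Finset.mem_image.1 ht'
    obtain ⟨s₃, hs₃, rfl⟩ := Finset.mem_image.1 hu
    obtain ⟨s₃', hs₃', rfl⟩ := Finset.mem_image.1 hu'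
    have key := h s hs s' hs' s₂ hs₂ s₂' hs₂' s₃ hs₃ s₃' hs₃' (by
      calc s * s'⁻¹ * g * (s₂ * s₂'⁻¹) * g * (s₃ * s₃'⁻¹) * g
          = (s * s'⁻¹ * (g * s₂ * (g * s₂')⁻¹) * (g * g * s₃ * (g * g * s₃')⁻¹)) * (g * g * g) := by group
        _ = 1 := by rw [heq, hg3]; group)
    exact ⟨key.1, by rw [key.2.1], by rw [key.2.2]⟩

/-- The same, as a statement about ONE set: `W := Q(S)·g` is uniquely cubing. [provable now] -/
theorem tpp_iff_uniquelyCubing (S : Finset G) (g : G) (hg : g ^ 3 = 1) :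
    TripleProductProperty S (S.image (g * ·)) (S.image (g * g * ·)) ↔
      UniquelyCubing ((S ×ˢ S).image fun p => p.1 * p.2⁻¹ * g) g := by
  rw [tpp_leftTranslates_iff S g hg]
  constructor
  · intro h w₁ hw₁ w₂ hw₂ w₃ hw₃ heq
    obtain ⟨⟨s₁, s₁'⟩, hp₁, rfl⟩ := Finset.mem_image.1 hw₁
    obtain ⟨⟨s₂, s₂'⟩, hp₂, rfl⟩ := Finset.mem_image.1 hw₂
    obtain ⟨⟨s₃, s₃'⟩, hp₃, rfl⟩ := Finset.mem_image.1 hw₃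
    rw [Finset.mem_product] at hp₁ hp₂ hp₃
    have key := h s₁ hp₁.1 s₁' hp₁.2 s₂ hp₂.1 s₂' hp₂.2 s₃ hp₃.1 s₃' hp₃.2 (by
      calc s₁ * s₁'⁻¹ * g * (s₂ * s₂'⁻¹) * g * (s₃ * s₃'⁻¹) * g
          = (s₁ * s₁'⁻¹ * g) * (s₂ * s₂'⁻¹ * g) * (s₃ * s₃'⁻¹ * g) := by group
        _ = 1 := heq)
    obtain ⟨h1, h2, h3⟩ := key
    subst h1 h2 h3
    simp
  · intro h s₁ hs₁ s₁' hs₁' s₂ hs₂ s₂' hs₂' s₃ hs₃ s₃' hs₃' heq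
    have hw : ∀ a ∈ S, ∀ b ∈ S, a * b⁻¹ * g ∈ (S ×ˢ S).image (fun p => p.1 * p.2⁻¹ * g) :=
      fun a ha b hb => Finset.mem_image.2 ⟨(a, b), Finset.mem_product.2 ⟨ha, hb⟩, rfl⟩
    have key := h _ (hw s₁ hs₁ s₁' hs₁') _ (hw s₂ hs₂ s₂' hs₂') _ (hw s₃ hs₃ s₃' hs₃') (by
      calc (s₁ * s₁'⁻¹ * g) * (s₂ * s₂'⁻¹ * g) * (s₃ * s₃'⁻¹ * g)
          = s₁ * s₁'⁻¹ * g * (s₂ * s₂'⁻¹) * g * (s₃ * s₃'⁻¹) * g := by group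
        _ = 1 := heq)
    have e : ∀ a b : G, a * b⁻¹ * g = g → a = b := fun a b hab => by
      have h1 : a * b⁻¹ = 1 := mul_right_cancel (hab.trans (one_mul g).symm)
      exact mul_inv_eq_one.1 h1
    exact ⟨e _ _ key.1, e _ _ key.2.1, e _ _ key.2.2⟩

/-- Collapse of single-point itinerary certificates: a quotient set of more than `n` permutations
meets every point stabiliser non-trivially (pigeonhole on `s⁻¹ x`); iterated, `|S| > n^{(t)}` forces
`Q(S) ∩ Stab(P) ≠ 1` for every `t`-set `P`, so certificates for `|S| ≈ √(n!)` must be multi-scale.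
[provable now] -/
theorem quotient_meets_stabilizer {n : ℕ} (S : Finset (Equiv.Perm (Fin n))) (x : Fin n)
    (h : n < S.card) : ∃ s ∈ S, ∃ s' ∈ S, s ≠ s' ∧ (s * s'⁻¹) x = x := by
  have hc : (Finset.univ : Finset (Fin n)).card < S.card := by simpa using h
  obtain ⟨s, hs, s', hs', hne, heq⟩ :=
    Finset.exists_ne_map_eq_of_card_lt_of_maps_to hc (f := fun σ : Equiv.Perm (Fin n) => σ.symm x)
      (fun a _ => Finset.mem_univ _)
  refine ⟨s, hs, s', hs', hne, ?_⟩
  simp only [Equiv.Perm.mul_apply, Equiv.Perm.inv_def]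
  rw [← heq, Equiv.apply_symm_apply]

end Triality

end Summit.MatrixMultiplication.MatrixMultiplication.Cruxes.ThresholdSubsetTriples.Ideator1
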